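import Literature.NumberTheory.Transcendental.BrownWindowCalculus
import Literature.NumberTheory.Transcendental.BrownZagierCompatibilityProofs
import HarnessLib

/-!
# Brown, *Mixed Tate motives over ℤ* (2012) — §§2.7, 3.2–4.1 formal: Lemma 2.7, Theorem 3.3,
# (3.9), Lemma 3.5 and the motivic Zagier formula (Theorem 4.3) from the full coaction, `H ↪ 𝒰`
# and the real theorem; hence `CoactionData` and the named fact from Brown's motivic structure

Sibling file of `BrownCoactionCalculus.lean` / `BrownWindowCalculus.lean`, in the cone of the named
fact `Literature.NumberTheory.Transcendental.hoffmanSpan_eq_mzvSpace` (Brown 2012, Theorem 1.1 ⟹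
Hoffman's Conjecture 2). `BrownCoactionCalculus` reduced the fact to `Brown2012.CoactionData`, whose
two non-structural axioms are the VALUES of the coefficients of `ζ_{2r+1}`:
`f_levelOne` (`c_{2^a32^b} = 2(-1)^{a+b+1}(A - B)`, i.e. (3.12) with Theorem 4.3 (4.2)) and
`f_zetaOne` (`c_{12^r} = 2(-1)^r`, Lemma 3.8). This file DERIVES them, following §§3.2–4.1 of the
paper, from Brown's motivic structure with the FULL operators `D_{2r+1} : H → 𝔏_{2r+1} ⊗ H`
(`Brown2012.PreCoactionData` / `Brown2012.FullCoactionData`) and — exactly as Brown does (Theorem 4.1 = [Zagier 2012]) — from the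
REAL evaluation of `ζ(2^a 3 2^b)`, taken as a hypothesis `hZ` in the form already used in
`BrownLevelOneProofs` (proved in this tree for weights `≤ 9`, `BrownZagierFormulaLowWeightProofs`).

## The input: `Brown2012.PreCoactionData` and `Brown2012.FullCoactionData`

A commutative `ℚ`-algebra `H` with weight pieces `H_N` (`J u = Iᵐ(0;u;1) ∈ H_{|u|}`, (2.16); I1:
`J ∅ = 1`; I0: `J(a⋯a) = 0`), the pieces `𝔏_{2r+1}` of the Lie coalgebra with
`π_r = p_{2r+1} ∘ π : H → 𝔏_{2r+1}` killing products of positive-weight elements ((3.1):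
`𝔏 = 𝒜_{>0}/𝒜_{>0}²`), the derivations `D_{2r+1}` ((3.3)) given on the `Iᵐ(0;v;1)` by Goncharov's formula
**(3.4)** (now with values in `𝔏_{2r+1} ⊗ H`), the functionals `ζ_{2r+1} ↦ 1` ((5.5), Lemma 3.2),
**Lemma 3.8** (motivic: `ζᵐ₁(2^n) = 2∑(-1)^i ζᵐ(2i+1)ζᵐ(2^{n-i})`, "granting the motivic stuffle
product formula" [Racinet 2002, Soudères 2010]; the relation (3.8) itself is not needed) and the
period map `per : H → ℝ` (an algebra homomorphism with `per ζᵐ = ζ`, (2.11), (2.19)) —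
`PreCoactionData` —, plus **Theorem 3.3**
(`ker D_{<N} ∩ H_N ⊆ ℚ ζᵐ(N)`, the one place where the structure of `MT(ℤ)` enters, via
`H ⊆ H^{MT⁺} ≅ 𝒰` and Lemma 2.7) and `dim H_N ≤ d_N` ((2.15), (2.23)) — `FullCoactionData`.

## What is proved

* `PreCoactionData.D_J_rho_singleton` — **(3.9)** `D_{2r+1} ζᵐ(N) = δ_{N,2r+1} ζ_{2r+1} ⊗ 1`,
  from (3.4) and I0; `PreCoactionData.D_zeta_mul_twos` — `D_{2r+1}(ζᵐ(2j+3)ζᵐ(2^m))` by (3.3),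
  (3.9), Lemma 3.4 (`WindowData.D_z_replicate_two`);
* `PreCoactionData.lemma_3_5` — **Lemma 3.5**:
  `D_{2r+1} ζᵐ(2^a32^b) = π(ξ^r_{a,b}) ⊗ ζᵐ(2^{a+b+1-r})`, from the exact window formula of
  `BrownWindowCalculus` in level one (`ξ^r_{a,b}` = the sum over the windows of types (2), (3):
  `∑ ζᵐ(2^α32^β) - ∑ ζᵐ(2^β32^α) + (I(b ≥ r) - I(a ≥ r)) ζᵐ₁(2^r)`, `K1_tt_iff`, `T1_tt_iff`,
  `T2_tt_iff`);
* `PreCoactionData.π_ξ` — `π(ξ^r_{a,b}) = 2(-1)^r(A^r_{a,b} - B^r_{a,b}) ζ_{2r+1}` given (3.12)/(4.2)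
  in lower weight and Lemma 3.8, collapsing by **Lemma 4.2** (`lemma_4_2_A/B` of the tree);
* `FullCoactionData.motivicZagier` — **Theorem 4.3** (Zagier's formula for the `ζᵐ(2^a32^b)`), by
  Brown's induction on the weight: Lemma 3.5 + `π_ξ` on the left, (3.3)/(3.9)/Lemma 3.4 on the right,
  Theorem 3.3, and the period map with the real theorem `hZ` and `ζ(2n+1) > 0` to kill the constant;
  `FullCoactionData.π_z_tt` — **(3.12) with (4.2)**;
* `FullCoactionData.toCoactionData`, `toMotivicCoactionData` — the `CoactionData` of
  `BrownCoactionCalculus` with `f r = (ζ_{2r+1} ↦ 1) ∘ π_r` ((5.5)), `D r = ((ζ_{2r+1} ↦ 1) ⊗ id) ∘ D_{2r+1}`, ALL FOUR of its axioms now theorems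
  (`ζᵐ(2^n) ≠ 0` via the period `ζ(2^n) > 0`);
* `hoffmanSpan_eq_mzvSpace_of_fullCoactionData` — **the named fact** from `FullCoactionData` and
  Zagier's real theorem;
* the `𝒰` side (§§2.5–2.7): `uWeight N` = the weight-`N` piece of `𝒰 = ℚ⟨f₃,f₅,…⟩ ⊗ ℚ[f₂]`
  (supported on the monomials counted by `card_brownMonomial_eq_zagierDim`, Lemma 2.5),
  `dU r = ∂_{2r+1} = (f^∨_{2r+1} ⊗ id) ∘ D_{2r+1}` (removal of the initial letter `f_{2r+1}`,
  (2.20)/(2.25)), `lemma_2_7` — **Lemma 2.7**, `finrank_uWeight` — `dim 𝒰_N = d_N`;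
  `UCoactionData` — the pre-coaction data with the embedding `φ : H ⊆ H^{MT⁺} ≅ 𝒰` ((2.15), (2.22),
  (3.6): weight-preserving, injective on `H_N`, intertwining the `ζ_{2r+1}`-components with `∂_{2r+1}`,
  `φ(ζᵐ(N)) ∈ ℚ^× f_N`) — from which **Theorem 3.3** (`UCoactionData.kernel`) and `dim H_N ≤ d_N`
  (`UCoactionData.finrank_le`) are derived: `UCoactionData.toFullCoactionData`,
  `hoffmanSpan_eq_mzvSpace_of_uCoactionData`.

With `BrownCoactionCalculus` (§§3.1, 5, 6), `BrownLevelMatrices` (§7.1, Theorem 7.3),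
`BrownLinearIndependence` (Theorem 7.4) and `BrownHoffmanModel` (§7.2), this completes the
formalization of Brown's paper modulo its external inputs: the existence of motivic multiple zeta
values with Goncharov's coaction and the period map (§2, [Goncharov 2005]), the comodule embedding
`H ⊆ H^{MT⁺} ≅ 𝒰` (the structure of `MT(ℤ)`: [Deligne–Goncharov 2005], Borel; §2.3), the motivic
Lemma 3.8 (stuffle), and Zagier's theorem [Zagier 2012]. No named facts are introduced (`FullCoactionData` is a
hypothesis bundle; `hZ` is an explicit hypothesis of the theorems, D-0026).

## References

* F. Brown, *Mixed Tate motives over ℤ*, Ann. of Math. **175** (2012), 949–976: §2.4 (I0–I3,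
  (2.16), (2.19)), §3.1 (3.1)–(3.4), Lemma 3.2, Theorem 3.3, Lemma 3.4, Lemma 3.5, (3.8), (3.9),
  Lemma 3.8, Theorem 4.1, Lemma 4.2, Theorem 4.3; §2.5 (2.20)–(2.25), Lemma 2.5, Definition 2.6,
  Lemma 2.7 (arXiv:1102.1312). [Brown2012]
* D. Zagier, *Evaluation of the multiple zeta values `ζ(2,…,2,3,2,…,2)`*, Ann. of Math. **175**
  (2012), 977–1000. [Zagier2012]
-/

namespace Literature.NumberTheory.Transcendental

namespace Brown2012

open MZV


open scoped TensorProduct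

/-- `Iᵐ(a; 0^{m+1}; b) = 0` when `J` vanishes on constant words (I0). [cite: Brown2012, §2.4 I0] -/
theorem Im_replicate_false_eq_zero {H : Type} [AddCommGroup H] [Module ℚ H] {J : List Bool → H}
    (hJ : ∀ m : ℕ, J (List.replicate (m + 1) false) = 0) (a b : Bool) (m : ℕ) :
    Im J a (List.replicate (m + 1) false) b = 0 := by
  cases a <;> cases b
  · exact Im_self J _ (by simp)
  · rw [Im_false_true, hJ]
  · rw [Im_true_false, List.reverse_replicate, hJ, smul_zero]
  · exact Im_self J _ (by simp)

/-- `ρ` of a word with positive letters has length the weight. [folklore] -/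
theorem length_rho_of_pos {w : List ℕ} (hw : ∀ a ∈ w, 1 ≤ a) : (rho w).length = weight w := by
  induction w with
  | nil => simp [weight]
  | cons a w ih =>
    rw [rho_cons, List.length_append, ih (fun i hi => hw i (by simp [hi])),
      length_rhoLetter (hw a (by simp)), weight_cons]

/-- **Brown's motivic structure, depth-one part** (what §§3.2–4.1 use): a commutative `ℚ`-algebra
`H` with weight pieces `H_N`, `J u = Iᵐ(0;u;1) ∈ H_{|u|}` (`J ∅ = 1` by I1, `J` of a constant word
`= 0` by I0), the Lie coalgebra pieces `𝔏_{2r+1}` with `π_r = p_{2r+1} ∘ π : H → 𝔏_{2r+1}` killing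
products of positive-weight elements ((3.1)), the derivations
`D_{2r+1} : H → 𝔏_{2r+1} ⊗ H` ((3.3)) given on the `Iᵐ(0;v;1)` by Goncharov's formula (3.4),
the functionals `ζ_{2r+1} ↦ 1` ((5.5); they exist by Lemma 3.2), Lemma 3.8 (motivic, "granting the
motivic stuffle product formula"), the period map (an algebra homomorphism, (2.11), (2.19)) and the dimension bound `dim H_N ≤ d_N`
((2.15), (2.23)). [cite: Brown2012, §§2.4–3.3, Theorem 3.3, Lemma 3.8] -/
structure PreCoactionData where
  /-- Brown's algebra `H` of motivic multiple zeta values. -/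
  H : Type
  [instCommRing : CommRing H]
  [instAlgebra : Algebra ℚ H]
  /-- `J u = Iᵐ(0; u; 1)`. -/
  J : List Bool → H
  /-- The weight-`N` piece `H_N`. -/
  Hw : ℕ → Submodule ℚ H
  /-- `Iᵐ(0; u; 1) ∈ H_{|u|}` ((2.16)). -/
  J_mem : ∀ u : List Bool, J u ∈ Hw u.length
  /-- The weight is multiplicative. -/
  mul_mem : ∀ {a b : ℕ} {x y : H}, x ∈ Hw a → y ∈ Hw b → x * y ∈ Hw (a + b)
  /-- I1: `Iᵐ(0; ∅; 1) = 1`. -/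
  J_nil : J [] = 1
  /-- I0: `Iᵐ(0; a⋯a; 1) = 0`. -/
  J_replicate : ∀ (m : ℕ) (b : Bool), J (List.replicate (m + 1) b) = 0
  /-- `𝔏_{2r+1}`. -/
  L : ℕ → Type
  [instL : ∀ r, AddCommGroup (L r)]
  [instLM : ∀ r, Module ℚ (L r)]
  /-- `π_r = p_{2r+1} ∘ π : H → 𝔏_{2r+1}` ((3.1)). -/
  π : (r : ℕ) → H →ₗ[ℚ] L r
  /-- `π` kills products of positive-weight elements (`𝔏 = 𝒜_{>0}/𝒜_{>0}²`). -/
  π_mul : ∀ (r : ℕ) {a b : ℕ} {x y : H}, 1 ≤ a → 1 ≤ b → x ∈ Hw a → y ∈ Hw b → π r (x * y) = 0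
  /-- `D_{2r+1} : H → 𝔏_{2r+1} ⊗ H` (Definition 3.1). -/
  D : (r : ℕ) → H →ₗ[ℚ] (L r ⊗[ℚ] H)
  /-- (3.3): the `D_{2r+1}` are derivations. -/
  D_mul : ∀ (r : ℕ) (x y : H), D r (x * y) =
    LinearMap.lTensor (L r) (LinearMap.mulLeft ℚ x) (D r y) +
      LinearMap.lTensor (L r) (LinearMap.mulLeft ℚ y) (D r x)
  /-- (3.4): Goncharov's formula on `Iᵐ(0; v; 1)`. -/
  coaction : ∀ r : ℕ, 1 ≤ r → ∀ v : List Bool,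
    D r (J v) = ∑ p ∈ Finset.range (v.length + 1 - (2 * r + 1)),
      π r (Im J (lft v p) (inner v (2 * r + 1) p) (rgt v (2 * r + 1) p)) ⊗ₜ J (quot v (2 * r + 1) p)
  /-- (5.5): the functional "`ζ_{2r+1} ↦ 1`" on `𝔏_{2r+1}` (it exists by Lemma 3.2, `ζ_{2r+1} ≠ 0`;
  Brown's choice is `f^∨_{2r+1}` through `𝔏 ↪ 𝔏(𝒰)`, (3.6)). -/
  dualζ : (r : ℕ) → L r →ₗ[ℚ] ℚ
  /-- `(ζ_{2r+1} ↦ 1)(π(ζᵐ(2r+1))) = 1`. -/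
  dualζ_ζ : ∀ r : ℕ, 1 ≤ r → dualζ r (π r (J (rho [2 * r + 1]))) = 1
  /-- Lemma 3.8 (motivic): `ζᵐ₁(2^n) = 2 ∑_{i=1}^{n} (-1)^i ζᵐ(2i+1) ζᵐ(2^{n-i})`. -/
  lemma_3_8 : ∀ n : ℕ, 1 ≤ n → J (false :: rho (List.replicate n 2)) =
    (2 : ℚ) • ∑ i ∈ Finset.range n, ((-1 : ℚ) ^ (i + 1)) •
      (J (rho [2 * i + 3]) * J (rho (List.replicate (n - 1 - i) 2)))
  /-- The period map (2.11), an algebra homomorphism. -/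
  per : H →ₐ[ℚ] ℝ
  /-- (2.19): `per (ζᵐ(n₁,…,n_r)) = ζ(n₁,…,n_r)` (Brown's order). -/
  per_J : ∀ s : List ℕ, IsAdmissible s → per (J (rho s.reverse)) = multipleZeta s

attribute [instance] PreCoactionData.instCommRing PreCoactionData.instAlgebra
  PreCoactionData.instL PreCoactionData.instLM

/-- **Brown's motivic structure** for §§3–4: the pre-coaction data together with **Theorem 3.3**
(`ker D_{<N} ∩ H_N ⊆ ℚ ζᵐ(N)`, from `H ⊆ H^{MT⁺} ≅ 𝒰` and Lemma 2.7 — the structure of `MT(ℤ)`)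
and the dimension bound `dim H_N ≤ d_N` ((2.15), (2.23)). [cite: Brown2012, Theorem 3.3 and (2.23)] -/
structure FullCoactionData extends PreCoactionData where
  /-- Theorem 3.3: `ker D_{<N} ∩ H_N ⊆ ℚ ζᵐ(N)` (`N ≥ 2`). -/
  kernel : ∀ N : ℕ, 2 ≤ N → ∀ ξ : H, ξ ∈ Hw N →
    (∀ r : ℕ, 1 ≤ r → 2 * r + 1 < N → D r ξ = 0) → ∃ c : ℚ, ξ = c • J (rho [N])
  /-- `H_N` is finite-dimensional … -/
  finiteDimensional : ∀ N, FiniteDimensional ℚ (Hw N)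
  /-- … of dimension `≤ d_N` ((2.15), (2.23)). -/
  finrank_le : ∀ N, Module.finrank ℚ (Hw N) ≤ zagierDim N

namespace PreCoactionData

variable (F : PreCoactionData)

/-- `ζᵐ(w) = J (ρ w)`. [cite: Brown2012, Definition 5.2] -/
def z (w : List ℕ) : F.H := F.J (rho w)

/-- `ζ_{2r+1} = π(ζᵐ(2r+1)) ∈ 𝔏_{2r+1}` (§5.2). [cite: Brown2012, §5.2] -/
def ζ (r : ℕ) : F.L r := F.π r (F.J (rho [2 * r + 1]))

/-- The full coaction as window data: `B r h y = π_r(h) ⊗ y`. [cite: Brown2012, (3.4)] -/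
abbrev toWindowData : WindowData where
  H := F.H
  J := F.J
  T := fun r => F.L r ⊗[ℚ] F.H
  B := fun r => (TensorProduct.mk ℚ (F.L r) F.H).comp (F.π r)
  D := F.D
  coaction := fun r hr v => by rw [F.coaction r hr v]; rfl

/-- `ζᵐ(w) ∈ H_{|w|}` for a word with positive letters. [cite: Brown2012, (2.16)] -/
theorem z_mem {w : List ℕ} (hw : ∀ a ∈ w, 1 ≤ a) : F.z w ∈ F.Hw (weight w) := by
  rw [z, ← length_rho_of_pos hw]; exact F.J_mem _

/-- `ζᵐ(w) ∈ H_{|w|}` for `w ∈ {2,3}^×`. [cite: Brown2012, (2.16)] -/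
theorem z_mem_hoffman {w : List ℕ} (hw : IsHoffman w) : F.z w ∈ F.Hw (weight w) :=
  F.z_mem fun a ha => by have := two_le_of_isHoffman hw ha; omega

/-! ### (3.9): `D_{2r+1}` on the depth-one elements -/

/-- **(3.9)**: `D_{2r+1} ζᵐ(N) = δ_{N,2r+1} π(ζᵐ(2r+1)) ⊗ 1` for `N ≥ 2`, `r ≥ 1` — from (3.4): the
only window with distinct endpoints and non-constant inner word is the whole sequence.
[cite: Brown2012, (3.9) and Lemma 3.2] -/
theorem D_J_rho_singleton {r N : ℕ} (hr : 1 ≤ r) (hN : 2 ≤ N) :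
    F.D r (F.J (rho [N])) = if N = 2 * r + 1 then F.π r (F.J (rho [N])) ⊗ₜ 1 else 0 := by
  set n := 2 * r + 1 with hn
  have hv : rho [N] = true :: List.replicate (N - 1) false := by simp [rhoLetter]
  have hlen : (rho [N]).length = N := by rw [hv]; simp; omega
  rw [F.coaction r hr, hlen]
  by_cases hNn : N = n
  · rw [if_pos hNn, show N + 1 - n = 1 by omega, Finset.sum_range_one, ← hn, lft_zero,
      inner_zero, rgt_of_eq (by rw [hlen]; omega), Im_false_true, quot_zero,
      List.take_of_length_le (by rw [hlen]; omega), List.drop_of_length_le (by rw [hlen]; omega), F.J_nil]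
  · rw [if_neg hNn]
    refine Finset.sum_eq_zero fun p hp => ?_
    have hp' := Finset.mem_range.1 hp
    rcases Nat.eq_zero_or_pos p with rfl | hpos
    · -- the window at `0`: right endpoint `a_{n+1} = 0 = a₀`
      rw [← hn, lft_zero, rgt_of_lt (by rw [hlen]; omega)]
      have : (rho [N])[0 + n]'(by rw [hlen]; omega) = false := by
        simp only [hv, Nat.zero_add]
        rw [List.getElem_cons]
        simp [show n ≠ 0 by omega]
      rw [this, Im_self _ _ (by rw [← List.length_pos_iff, length_inner (by rw [hlen]; omega)]; omega),
        map_zero, TensorProduct.zero_tmul]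
    · -- the inner word is `0^n`
      have hinner : inner (rho [N]) n p = List.replicate n false := by
        rw [inner, hv, show p = (p - 1) + 1 by omega, List.drop_succ_cons, List.drop_replicate,
          List.take_replicate]
        congr 1
        omega
      rw [← hn, hinner, show n = (n - 1) + 1 by omega,
        Im_replicate_false_eq_zero (fun m => F.J_replicate m false), map_zero, TensorProduct.zero_tmul]

/-- `D_{2r+1}(ζᵐ(2j+3) ζᵐ(2^m)) = δ_{j+1,r} ζ_{2r+1} ⊗ ζᵐ(2^m)` by (3.3), (3.9) and Lemma 3.4.
[cite: Brown2012, proof of Corollary 3.6] -/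
theorem D_zeta_mul_twos {r : ℕ} (hr : 1 ≤ r) (j m : ℕ) :
    F.D r (F.J (rho [2 * j + 3]) * F.z (List.replicate m 2)) =
      if j + 1 = r then F.ζ r ⊗ₜ F.z (List.replicate m 2) else 0 := by
  have h2 : F.D r (F.z (List.replicate m 2)) = 0 := F.toWindowData.D_z_replicate_two hr m
  rw [F.D_mul, h2, map_zero, zero_add, F.D_J_rho_singleton hr (by omega)]
  by_cases hj : j + 1 = r
  · subst hj
    rw [if_pos (by ring), if_pos rfl, LinearMap.lTensor_tmul, LinearMap.mulLeft_apply, mul_one, ζ,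
      show 2 * (j + 1) + 1 = 2 * j + 3 by ring]
  · rw [if_neg (by omega), if_neg hj, map_zero]

/-! ### `π` on the depth-one combinations -/

/-- `π_r` of `∑_j κ_j ζᵐ(2j+3) ζᵐ(2^{n-1-j})` keeps only the term `j = n - 1 = r - 1`.
[cite: Brown2012, proof of Corollary 3.6] -/
theorem π_sum_zeta_mul_twos {n : ℕ} (hn : 1 ≤ n) (κ : ℕ → ℚ) :
    F.π n (∑ j ∈ Finset.range n, κ j • (F.J (rho [2 * j + 3]) * F.z (List.replicate (n - 1 - j) 2))) =
      κ (n - 1) • F.ζ n := by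
  rw [map_sum, Finset.sum_eq_single (n - 1)]
  · rw [map_smul, show n - 1 - (n - 1) = 0 by omega, List.replicate_zero, z, rho_nil, F.J_nil, mul_one,
      ζ, show 2 * (n - 1) + 3 = 2 * n + 1 by omega]
  · intro j hj hjn
    have hj' := Finset.mem_range.1 hj
    rw [map_smul, F.π_mul n (a := 2 * j + 3) (b := 2 * (n - 1 - j)) (by omega) (by omega), smul_zero]
    · have := F.J_mem (rho [2 * j + 3])
      rwa [length_rho_of_pos (by simp)] at this
    · have := F.z_mem_hoffman (isHoffman_replicate_two (n - 1 - j))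
      rwa [weight_replicate_two] at this
  · intro h
    exact absurd (Finset.mem_range.2 (by omega)) h

/-- `c_{12^r} = 2(-1)^r`: `π_r(ζᵐ₁(2^r)) = 2(-1)^r ζ_{2r+1}` from Lemma 3.8.
[cite: Brown2012, Lemma 3.8 and (3.11)–(3.12)] -/
theorem π_zetaOne {r : ℕ} (hr : 1 ≤ r) :
    F.π r (F.J (false :: rho (List.replicate r 2))) = (2 * (-1 : ℚ) ^ r) • F.ζ r := by
  rw [F.lemma_3_8 r hr, map_smul]
  have := F.π_sum_zeta_mul_twos hr (fun i => (-1 : ℚ) ^ (i + 1))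
  simp only [z] at this ⊢
  rw [this, smul_smul, show r - 1 + 1 = r by omega]


/-- The `ζ_{2r+1}`-component `((ζ_{2r+1} ↦ 1) ⊗ id) ∘ D_{2r+1} : H → H` (Definition 5.7 with (5.5)).
[cite: Brown2012, Definition 5.7] -/
noncomputable def Dc (r : ℕ) : F.H →ₗ[ℚ] F.H :=
  (TensorProduct.lid ℚ F.H).toLinearMap ∘ₗ TensorProduct.map (F.dualζ r) LinearMap.id ∘ₗ F.D r

/-- (3.4) for the component: `Dc r (Iᵐ(0;v;1)) = ∑ (ζ_{2r+1} ↦ 1)(π_r(Iᵐ(window))) • Iᵐ(0; quotient; 1)`.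
[cite: Brown2012, (3.4)] -/
theorem Dc_J (r : ℕ) (hr : 1 ≤ r) (v : List Bool) :
    F.Dc r (F.J v) = ∑ p ∈ Finset.range (v.length + 1 - (2 * r + 1)),
      F.dualζ r (F.π r (Im F.J (lft v p) (inner v (2 * r + 1) p) (rgt v (2 * r + 1) p))) •
        F.J (quot v (2 * r + 1) p) := by
  simp only [Dc, LinearMap.comp_apply, LinearEquiv.coe_coe, F.coaction r hr v, map_sum,
    TensorProduct.map_tmul, TensorProduct.lid_tmul, LinearMap.id_apply]

/-! ### Lemma 3.5: `D_{2r+1}` of the level-one elements `ζᵐ(2^a 3 2^b)` -/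

end PreCoactionData

/-- Brown's word `2^{a} 3 2^{b}` (in his order). [cite: Brown2012, §3.3] -/
def tt (a b : ℕ) : List ℕ := List.replicate a 2 ++ 3 :: List.replicate b 2

/-- `len(2^a 3 2^b) = a + b + 1`. [folklore] -/
@[simp] theorem length_tt (a b : ℕ) : (tt a b).length = a + b + 1 := by simp [tt]; omega

/-- `2^a 3 2^b ∈ {2,3}^×`. [folklore] -/
theorem isHoffman_tt (a b : ℕ) : IsHoffman (tt a b) := isHoffman_twos_three_twos a b

/-- `deg₃(2^a 3 2^b) = 1`. [folklore] -/
theorem level_tt (a b : ℕ) : level (tt a b) = 1 := by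
  simp [tt, level, List.count_append, List.count_replicate]

/-- `|2^a 3 2^b| = 2(a+b) + 3`. [folklore] -/
theorem weight_tt (a b : ℕ) : weight (tt a b) = 2 * (a + b) + 3 := by
  simp only [tt, weight, List.sum_append, List.sum_cons, List.sum_replicate, smul_eq_mul]; ring

/-- The reversal of `2^a 3 2^b` is `2^b 3 2^a`. [folklore] -/
theorem reverse_tt (a b : ℕ) : (tt a b).reverse = tt b a := reverse_replicate_append_three a b

/-- `(2^a 3 2^b)⇂i = 2^{a-i} 3 2^b` for `i ≤ a`. [folklore] -/
theorem drop_tt_of_le {a b i : ℕ} (hi : i ≤ a) : (tt a b).drop i = tt (a - i) b := by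
  rw [tt, List.drop_append_of_le_length (by simpa using hi), List.drop_replicate, tt]

/-- `(2^a 3 2^b)⇂i = 2^{a+b+1-i}` for `i > a`. [folklore] -/
theorem drop_tt_of_lt {a b i : ℕ} (hi : a < i) : (tt a b).drop i = List.replicate (a + b + 1 - i) 2 := by
  rw [tt, List.drop_append, List.drop_of_length_le (by simp; omega), List.nil_append,
    List.length_replicate, show i - a = (i - a - 1) + 1 by omega, List.drop_succ_cons, List.drop_replicate]
  congr 1
  omega

/-- `(2^a 3 2^b)↾i = 2^i` for `i ≤ a`. [folklore] -/
theorem take_tt_of_le {a b i : ℕ} (hi : i ≤ a) : (tt a b).take i = List.replicate i 2 := by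
  rw [tt, List.take_append_of_le_length (by simpa using hi), List.take_replicate, min_eq_left hi]

/-- `(2^a 3 2^b)↾i = 2^a 3 2^{i-a-1}` for `a < i ≤ a+b+1`. [folklore] -/
theorem take_tt_of_lt {a b i : ℕ} (hi : a < i) (hi' : i ≤ a + b + 1) : (tt a b).take i = tt a (i - a - 1) := by
  rw [tt, List.take_append, List.take_of_length_le (by simp; omega), List.length_replicate,
    show i - a = (i - a - 1) + 1 by omega, List.take_succ_cons, List.take_replicate,
    min_eq_left (by omega), tt, Nat.add_sub_cancel]

/-- `deg₃` of a prefix of `2^a 3 2^b`. [folklore] -/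
theorem level_take_tt (a b i : ℕ) (hi' : i ≤ a + b + 1) :
    level ((tt a b).take i) = if a < i then 1 else 0 := by
  split_ifs with h
  · rw [take_tt_of_lt h hi', level_tt]
  · rw [take_tt_of_le (by omega), level_replicate_two]

/-- `deg₃` of a suffix of `2^a 3 2^b`. [folklore] -/
theorem level_drop_tt (a b j : ℕ) : level ((tt a b).drop j) = if j ≤ a then 1 else 0 := by
  split_ifs with h
  · rw [drop_tt_of_le h, level_tt]
  · rw [drop_tt_of_lt (by omega), level_replicate_two]

/-- The type-(3) windows of `ζᵐ(2^a 3 2^b)`: the factor of `r` letters at `i` has level one iff it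
contains the `3`, i.e. `i ≤ a < i + r`. [cite: Brown2012, proof of Lemma 3.5] -/
theorem K1_tt_iff {a b r i : ℕ} (hr : 1 ≤ r) :
    K1 (tt a b) r i ↔ i ≤ a ∧ a < i + r ∧ i + r ≤ a + b + 1 := by
  rw [K1, length_tt, vK]
  constructor
  · rintro ⟨hle, hl⟩
    have h3 := level_three_parts (tt a b) i r
    rw [level_tt, level_take_tt a b i (by omega), hl, level_drop_tt] at h3
    refine ⟨?_, ?_, hle⟩
    · by_contra h; rw [if_pos (by omega)] at h3; omega
    · by_contra h; rw [if_neg (by omega), if_pos (by omega)] at h3; omega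
  · rintro ⟨h1, h2, h3⟩
    refine ⟨h3, ?_⟩
    have h := level_three_parts (tt a b) i r
    rw [level_tt, level_take_tt a b i (by omega), if_neg (by omega), level_drop_tt, if_neg (by omega)] at h
    omega

/-- … and then it is `2^{a-i} 3 2^{r-1-(a-i)}`. [cite: Brown2012, proof of Lemma 3.5] -/
theorem vK_tt {a b r i : ℕ} (h : i ≤ a ∧ a < i + r ∧ i + r ≤ a + b + 1) :
    vK (tt a b) r i = tt (a - i) (r - 1 - (a - i)) := by
  obtain ⟨h1, h2, h3⟩ := h
  rw [vK, drop_tt_of_le h1, take_tt_of_lt (by omega) (by omega)]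
  congr 1
  omega

/-- The type-(2) window of the first kind: `3 2^r` at `i` iff `i = a` and `r ≤ b`.
[cite: Brown2012, proof of Lemma 3.5] -/
theorem T1_tt_iff {a b r i : ℕ} : T1 (tt a b) r i ↔ i = a ∧ r ≤ b := by
  rw [T1]
  constructor
  · intro h
    have hi : i ≤ a + b + 1 := by
      by_contra hlt
      rw [List.drop_of_length_le (by simp; omega)] at h
      simp at h
    rcases Nat.lt_or_ge a i with hlt | hge
    · rw [drop_tt_of_lt hlt, List.take_replicate] at h
      have := congrArg (fun l => (3 : ℕ) ∈ l) h
      simp at this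
    · rw [drop_tt_of_le hge] at h
      rcases Nat.eq_or_lt_of_le hge with rfl | hlt
      · refine ⟨rfl, ?_⟩
        rw [Nat.sub_self, tt, List.replicate_zero, List.nil_append, List.take_succ_cons,
          List.take_replicate, List.cons.injEq] at h
        have := congrArg List.length h.2
        simp at this
        omega
      · exfalso
        rw [tt, show a - i = (a - i - 1) + 1 by omega, List.replicate_succ, List.cons_append,
          List.take_succ_cons] at h
        simp at h
  · rintro ⟨rfl, hrb⟩
    rw [drop_tt_of_le le_rfl, Nat.sub_self, tt, List.replicate_zero, List.nil_append, List.take_succ_cons,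
      List.take_replicate, min_eq_left hrb]

/-- The type-(2) window of the second kind: `2^r 3` at `i` iff `i + r = a`.
[cite: Brown2012, proof of Lemma 3.5] -/
theorem T2_tt_iff {a b r i : ℕ} : T2 (tt a b) r i ↔ i + r = a := by
  rw [T2]
  constructor
  · intro h
    rcases Nat.lt_or_ge a i with hlt | hge
    · rw [drop_tt_of_lt hlt, List.take_replicate] at h
      have := congrArg (fun l => (3 : ℕ) ∈ l) h
      simp at this
    · rw [drop_tt_of_le hge, tt, List.take_append] at h
      rcases Nat.lt_or_ge (a - i) (r + 1) with h1 | h1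
      · rw [List.take_of_length_le (by simp; omega), List.length_replicate,
          show r + 1 - (a - i) = (r - (a - i)) + 1 by omega, List.take_succ_cons] at h
        have := (replicate_two_append_three_inj (x := List.take (r - (a - i)) (List.replicate b 2))
          (y := []) (by simpa using h)).1
        omega
      · exfalso
        rw [List.take_replicate, min_eq_left (by omega), List.length_replicate,
          show r + 1 - (a - i) = 0 by omega, List.take_zero, List.append_nil] at h
        have := congrArg (fun l => (3 : ℕ) ∈ l) h
        simp at this
  · intro h
    rw [drop_tt_of_le (by omega), show a - i = r by omega, tt, List.take_append,
      List.take_of_length_le (by simp), List.length_replicate, Nat.add_sub_cancel_left,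
      List.take_succ_cons, List.take_zero]

/-- The quotient of a type-(3) window of `ζᵐ(2^a32^b)` is `2^{a+b+1-r}`. [cite: Brown2012, Lemma 3.5] -/
theorem qK_tt {a b r i : ℕ} (hK : K1 (tt a b) r i) : qK (tt a b) r i = List.replicate (a + b + 1 - r) 2 := by
  obtain ⟨hwt, hl⟩ := weight_qK_level_qK (isHoffman_tt a b) hK
  rw [level_tt] at hl
  rw [weight_tt] at hwt
  have hq : IsHoffman (qK (tt a b) r i) := isHoffman_qK (isHoffman_tt a b) r i
  have h0 := eq_replicate_two_of_level_eq_zero hq (by omega)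
  have hw2 := weight_eq_two_mul_length_add_level hq
  rw [h0]
  congr 1
  omega

/-- The quotient of a type-(2) window of `ζᵐ(2^a32^b)` is `2^{a+b+1-r}`. [cite: Brown2012, Lemma 3.5] -/
theorem qT_tt {a b r i : ℕ} (hT : T1 (tt a b) r i ∨ T2 (tt a b) r i) :
    qT (tt a b) r i = List.replicate (a + b + 1 - r) 2 := by
  obtain ⟨hwt, hl⟩ := weight_qT_level_qT hT
  rw [level_tt] at hl
  rw [weight_tt] at hwt
  have hq : IsHoffman (qT (tt a b) r i) := isHoffman_qT (isHoffman_tt a b) r i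
  have h0 := eq_replicate_two_of_level_eq_zero hq (by omega)
  have hw2 := weight_eq_two_mul_length_add_level hq
  rw [h0]
  congr 1
  omega

/-- Reindexing the type-(3) windows of `ζᵐ(2^a32^b)` by `α = a - i` (the number of `2`s before the
`3` in the factor). [cite: Brown2012, Lemma 3.5] -/
theorem sum_K1_reindex (a b r : ℕ) (g : ℕ → ℚ) :
    ∑ i ∈ Finset.range (a + b + 1 + 1),
        (if i ≤ a ∧ a < i + r ∧ i + r ≤ a + b + 1 then g (a - i) else 0) =
      ∑ α ∈ (Finset.range r).filter (fun α => α ≤ a ∧ r - 1 - α ≤ b), g α := by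
  rw [← Finset.sum_filter]
  refine Finset.sum_nbij' (fun i => a - i) (fun α => a - α) ?_ ?_ ?_ ?_ ?_
  · intro i hi
    simp only [Finset.mem_filter, Finset.mem_range] at hi ⊢
    omega
  · intro α hα
    simp only [Finset.mem_filter, Finset.mem_range] at hα ⊢
    omega
  · intro i hi
    simp only [Finset.mem_filter, Finset.mem_range] at hi
    show a - (a - i) = i
    omega
  · intro α hα
    simp only [Finset.mem_filter, Finset.mem_range] at hα
    show a - (a - α) = α
    omega
  · intro i _
    rfl

/-- The same for the right neighbours (`β < b`). [cite: Brown2012, Lemma 3.5] -/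
theorem sum_K2_reindex (a b r : ℕ) (g : ℕ → ℚ) :
    ∑ i ∈ Finset.range (a + b + 1 + 1),
        (if (i ≤ a ∧ a < i + r ∧ i + r ≤ a + b + 1) ∧ i + r < a + b + 1 then g (a - i) else 0) =
      ∑ α ∈ (Finset.range r).filter (fun α => α ≤ a ∧ r - 1 - α < b), g α := by
  rw [← Finset.sum_filter]
  refine Finset.sum_nbij' (fun i => a - i) (fun α => a - α) ?_ ?_ ?_ ?_ ?_
  · intro i hi
    simp only [Finset.mem_filter, Finset.mem_range] at hi ⊢
    omega
  · intro α hα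
    simp only [Finset.mem_filter, Finset.mem_range] at hα ⊢
    omega
  · intro i hi
    simp only [Finset.mem_filter, Finset.mem_range] at hi
    show a - (a - i) = i
    omega
  · intro α hα
    simp only [Finset.mem_filter, Finset.mem_range] at hα
    show a - (a - α) = α
    omega
  · intro i _
    rfl

/-- `c_{2^α32^β}` in terms of `A, B` for `α + β + 1 = r`. [cite: Brown2012, (4.2)] -/
theorem zagierCoeff_eq_AB {α r : ℕ} (hα : α < r) :
    zagierCoeff α (r - 1 - α) = 2 * (-1) ^ r * (zagierA r α - zagierB r (r - 1 - α)) := by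
  rw [zagierCoeff_def, show α + (r - 1 - α) + 1 = r by omega]

namespace PreCoactionData

variable (F : PreCoactionData)

/-- Brown's `ξ^r_{a,b}` of **Lemma 3.5**, written as the sum over the contributing windows of
`(0; ρ(2^a32^b); 1)`: `∑ ζᵐ(2^α32^β) - ∑ ζᵐ(2^β32^α) + (I(b ≥ r) - I(a ≥ r)) ζᵐ₁(2^r)`.
[cite: Brown2012, Lemma 3.5] -/
def ξ (r a b : ℕ) : F.H :=
  ∑ i ∈ Finset.range ((tt a b).length + 1),
    ((if K1 (tt a b) r i then F.J (rho (vK (tt a b) r i)) else 0) -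
      (if K1 (tt a b) r i ∧ i + r < (tt a b).length then F.J (rho (vK (tt a b) r i).reverse) else 0) +
      (if T1 (tt a b) r i then F.J (false :: rho (List.replicate r 2)) else 0) -
      (if T2 (tt a b) r i then F.J (false :: rho (List.replicate r 2)) else 0))

/-- **Brown 2012, Lemma 3.5, from (3.4)**: `D_{2r+1} ζᵐ(2^a 3 2^b) = π(ξ^r_{a,b}) ⊗ ζᵐ(2^{a+b+1-r})`
(all contributing windows have the same quotient `ρ(2^{a+b+1-r})`; the others vanish by I0).
[cite: Brown2012, Lemma 3.5] -/
theorem lemma_3_5 {r : ℕ} (hr : 1 ≤ r) (a b : ℕ) :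
    F.D r (F.z (tt a b)) = F.π r (F.ξ r a b) ⊗ₜ F.z (List.replicate (a + b + 1 - r) 2) := by
  have h := F.toWindowData.lhs_eq_rhs_of_level_le_one hr (isHoffman_tt a b) (by rw [level_tt]) []
  rw [← WindowData.D_z_eq_lhs _ hr] at h
  change F.D r (F.z (tt a b)) = F.toWindowData.rhs r [] (tt a b) at h
  rw [h, WindowData.rhs, ξ, map_sum, TensorProduct.sum_tmul]
  refine Finset.sum_congr rfl fun i _ => ?_
  set y := F.z (List.replicate (a + b + 1 - r) 2) with hy
  have e1 : F.toWindowData.gK1 r [] (tt a b) i =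
      F.π r (if K1 (tt a b) r i then F.J (rho (vK (tt a b) r i)) else 0) ⊗ₜ y := by
    by_cases hK : K1 (tt a b) r i
    · rw [WindowData.gK1, if_pos hK, if_pos hK]
      show F.π r (F.J (rho (vK (tt a b) r i))) ⊗ₜ F.J (rho ([] ++ qK (tt a b) r i)) = _
      rw [List.nil_append, qK_tt hK, hy, z]
    · rw [WindowData.gK1, if_neg hK, if_neg hK, map_zero, TensorProduct.zero_tmul]
  have e2 : F.toWindowData.gK2 r [] (tt a b) i =
      F.π r (if K1 (tt a b) r i ∧ i + r < (tt a b).length then F.J (rho (vK (tt a b) r i).reverse)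
        else 0) ⊗ₜ y := by
    by_cases hK : K1 (tt a b) r i ∧ i + r < (tt a b).length
    · rw [WindowData.gK2, if_pos hK, if_pos hK]
      show F.π r (F.J (rho (vK (tt a b) r i).reverse)) ⊗ₜ F.J (rho ([] ++ qK (tt a b) r i)) = _
      rw [List.nil_append, qK_tt hK.1, hy, z]
    · rw [WindowData.gK2, if_neg hK, if_neg hK, map_zero, TensorProduct.zero_tmul]
  have e3 : F.toWindowData.gT1 r [] (tt a b) i =
      F.π r (if T1 (tt a b) r i then F.J (false :: rho (List.replicate r 2)) else 0) ⊗ₜ y := by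
    by_cases hT : T1 (tt a b) r i
    · rw [WindowData.gT1, if_pos hT, if_pos hT]
      show F.π r (F.J (false :: rho (List.replicate r 2))) ⊗ₜ F.J (rho ([] ++ qT (tt a b) r i)) = _
      rw [List.nil_append, qT_tt (Or.inl hT), hy, z]
    · rw [WindowData.gT1, if_neg hT, if_neg hT, map_zero, TensorProduct.zero_tmul]
  have e4 : F.toWindowData.gT2 r [] (tt a b) i =
      F.π r (if T2 (tt a b) r i then F.J (false :: rho (List.replicate r 2)) else 0) ⊗ₜ y := by
    by_cases hT : T2 (tt a b) r i
    · rw [WindowData.gT2, if_pos hT, if_pos hT]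
      show F.π r (F.J (false :: rho (List.replicate r 2))) ⊗ₜ F.J (rho ([] ++ qT (tt a b) r i)) = _
      rw [List.nil_append, qT_tt (Or.inr hT), hy, z]
    · rw [WindowData.gT2, if_neg hT, if_neg hT, map_zero, TensorProduct.zero_tmul]
  rw [e1, e2, e3, e4, map_sub, map_add, map_sub, TensorProduct.sub_tmul, TensorProduct.add_tmul,
    TensorProduct.sub_tmul]

/-- `π(ξ^r_{a,b}) = 2(-1)^r (A^r_{a,b} - B^r_{a,b}) ζ_{2r+1}` given (3.12)/(4.2) for the words of
weight `2r+1 < 2(a+b)+3` and Lemma 3.8 — the computation in the proof of Theorem 4.3, collapsing by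
**Lemma 4.2**. [cite: Brown2012, proof of Theorem 4.3 and Lemma 4.2] -/
theorem π_ξ {r a b : ℕ} (hr : 1 ≤ r) (hrab : r ≤ a + b)
    (ih : ∀ α β : ℕ, α + β + 1 = r → F.π r (F.z (tt α β)) = zagierCoeff α β • F.ζ r) :
    F.π r (F.ξ r a b) = (2 * (-1 : ℚ) ^ r * (zagierA r a - zagierB r b)) • F.ζ r := by
  have hlen : (tt a b).length = a + b + 1 := length_tt a b
  -- the four sums
  have S1 : ∑ i ∈ Finset.range ((tt a b).length + 1),
      F.π r (if K1 (tt a b) r i then F.J (rho (vK (tt a b) r i)) else 0) =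
      (∑ α ∈ (Finset.range r).filter (fun α => α ≤ a ∧ r - 1 - α ≤ b), zagierCoeff α (r - 1 - α)) •
        F.ζ r := by
    rw [hlen, ← sum_K1_reindex a b r (fun α => zagierCoeff α (r - 1 - α)), Finset.sum_smul]
    simp_rw [ite_smul, zero_smul]
    refine Finset.sum_congr rfl fun i _ => ?_
    by_cases h : i ≤ a ∧ a < i + r ∧ i + r ≤ a + b + 1
    · rw [if_pos ((K1_tt_iff hr).2 h), if_pos h, vK_tt h, ← z, ih _ _ (by omega)]
    · rw [if_neg (fun hK => h ((K1_tt_iff hr).1 hK)), if_neg h, map_zero]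
  have S2 : ∑ i ∈ Finset.range ((tt a b).length + 1),
      F.π r (if K1 (tt a b) r i ∧ i + r < (tt a b).length then F.J (rho (vK (tt a b) r i).reverse)
        else 0) =
      (∑ α ∈ (Finset.range r).filter (fun α => α ≤ a ∧ r - 1 - α < b), zagierCoeff (r - 1 - α) α) •
        F.ζ r := by
    rw [hlen, ← sum_K2_reindex a b r (fun α => zagierCoeff (r - 1 - α) α), Finset.sum_smul]
    simp_rw [ite_smul, zero_smul]
    refine Finset.sum_congr rfl fun i _ => ?_
    by_cases h : (i ≤ a ∧ a < i + r ∧ i + r ≤ a + b + 1) ∧ i + r < a + b + 1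
    · rw [if_pos ⟨(K1_tt_iff hr).2 h.1, h.2⟩, if_pos h, vK_tt h.1, reverse_tt, ← z, ih _ _ (by omega)]
    · rw [if_neg (fun hK => h ⟨(K1_tt_iff hr).1 hK.1, hK.2⟩), if_neg h, map_zero]
  have S3 : ∑ i ∈ Finset.range ((tt a b).length + 1),
      F.π r (if T1 (tt a b) r i then F.J (false :: rho (List.replicate r 2)) else 0) =
      (if r ≤ b then 2 * (-1 : ℚ) ^ r else 0) • F.ζ r := by
    simp_rw [T1_tt_iff]
    rw [Finset.sum_eq_single a]
    · by_cases h : r ≤ b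
      · rw [if_pos ⟨rfl, h⟩, if_pos h, F.π_zetaOne hr]
      · rw [if_neg (fun h' => h h'.2), if_neg h, map_zero, zero_smul]
    · intro i _ hi
      rw [if_neg (fun h' => hi h'.1), map_zero]
    · intro h
      exact absurd (Finset.mem_range.2 (by rw [hlen]; omega)) h
  have S4 : ∑ i ∈ Finset.range ((tt a b).length + 1),
      F.π r (if T2 (tt a b) r i then F.J (false :: rho (List.replicate r 2)) else 0) =
      (if r ≤ a then 2 * (-1 : ℚ) ^ r else 0) • F.ζ r := by
    simp_rw [T2_tt_iff]
    by_cases h : r ≤ a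
    · rw [Finset.sum_eq_single (a - r), if_pos (by omega), if_pos h, F.π_zetaOne hr]
      · intro i _ hi
        rw [if_neg (by omega), map_zero]
      · intro h'
        exact absurd (Finset.mem_range.2 (by rw [hlen]; omega)) h'
    · rw [if_neg h, zero_smul]
      refine Finset.sum_eq_zero fun i _ => ?_
      rw [if_neg (by omega), map_zero]
  rw [ξ, map_sum]
  simp_rw [map_sub, map_add, map_sub]
  rw [Finset.sum_sub_distrib, Finset.sum_add_distrib, Finset.sum_sub_distrib, S1, S2, S3, S4,
    ← sub_smul, ← add_smul, ← sub_smul]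
  congr 1
  have hA := lemma_4_2_A a b r hr (by omega)
  have hB := lemma_4_2_B a b r (by omega)
  have hS1 : ∑ α ∈ (Finset.range r).filter (fun α => α ≤ a ∧ r - 1 - α ≤ b), zagierCoeff α (r - 1 - α) =
      ∑ α ∈ (Finset.range r).filter (fun α => α ≤ a ∧ r - 1 - α ≤ b),
        2 * (-1) ^ r * (zagierA r α - zagierB r (r - 1 - α)) :=
    Finset.sum_congr rfl fun α hα => zagierCoeff_eq_AB (Finset.mem_range.1 (Finset.mem_filter.1 hα).1)
  have hS2 : ∑ α ∈ (Finset.range r).filter (fun α => α ≤ a ∧ r - 1 - α < b), zagierCoeff (r - 1 - α) α =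
      ∑ α ∈ (Finset.range r).filter (fun α => α ≤ a ∧ r - 1 - α < b),
        2 * (-1) ^ r * (zagierA r (r - 1 - α) - zagierB r α) :=
    Finset.sum_congr rfl fun α hα => by
      have hαr := Finset.mem_range.1 (Finset.mem_filter.1 hα).1
      have := zagierCoeff_eq_AB (α := r - 1 - α) (r := r) (by omega)
      rwa [show r - 1 - (r - 1 - α) = α by omega] at this
  rw [hS1, hS2, ← Finset.mul_sum, ← Finset.mul_sum, Finset.sum_sub_distrib, Finset.sum_sub_distrib]
  split_ifs at hA ⊢ <;> linear_combination (2 * (-1 : ℚ) ^ r) * hA - (2 * (-1 : ℚ) ^ r) * hB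

end PreCoactionData

namespace FullCoactionData

variable (F : FullCoactionData)

/-! ### Theorem 4.3: the motivic Zagier formula -/

/-- Zagier's coefficient of `ζ(2j+3) ζ(2^{n-1-j})` in `ζ(2^a 3 2^b)`:
`2(-1)^{j+1}(A^{j+1}_{a,b} - B^{j+1}_{a,b})` (`r = j + 1`). [cite: Brown2012, Theorem 4.1] -/
def κ (a b j : ℕ) : ℚ := 2 * (-1) ^ (j + 1) * (zagierA (j + 1) a - zagierB (j + 1) b)

/-- **Brown 2012, Theorem 4.3 (Zagier's theorem lifts to motivic multiple zeta values)**, from the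
structure `FullCoactionData` and the REAL theorem (Theorem 4.1, Zagier 2012 — here the hypothesis
`hZ`, in the form used in `BrownLevelOneProofs`): for all `a, b`,
`ζᵐ(2^a 3 2^b) = 2 ∑_{r=1}^{a+b+1} (-1)^r (A^r_{a,b} - B^r_{a,b}) ζᵐ(2r+1) ζᵐ(2^{a+b+1-r})`.
Proof: Brown's induction on the weight — Lemma 3.5, the induction hypothesis through (3.12),
Lemma 3.8 and Lemma 4.2 (`π_ξ`), (3.3)/(3.9)/Lemma 3.4 on the right-hand side, Theorem 3.3, and the
period map with the real theorem to kill the multiple of `ζᵐ(2n+1)` (`ζ(2n+1) ≠ 0`).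
[cite: Brown2012, Theorem 4.3] -/
theorem motivicZagier
    (hZ : ∀ n b : ℕ, b < n →
      multipleZeta (List.replicate b 2 ++ 3 :: List.replicate (n - 1 - b) 2) =
        2 * ∑ r ∈ Finset.range n, (-1 : ℝ) ^ (r + 1) *
          ((zagierA (r + 1) (n - 1 - b) - zagierB (r + 1) b : ℚ) : ℝ) *
            (multipleZeta [2 * r + 3] * multipleZeta (List.replicate (n - 1 - r) 2))) :
    ∀ n a b : ℕ, a + b + 1 = n →
      F.z (tt a b) = ∑ j ∈ Finset.range n, κ a b j • (F.J (rho [2 * j + 3]) * F.z (List.replicate (n - 1 - j) 2)) := by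
  intro n
  induction n using Nat.strong_induction_on with
  | _ n ih =>
  intro a b hab
  -- (3.12)/(4.2) in smaller weights, from the induction hypothesis
  have ihπ : ∀ r, 1 ≤ r → r < n → ∀ α β : ℕ, α + β + 1 = r →
      F.π r (F.z (tt α β)) = zagierCoeff α β • F.ζ r := by
    intro r hr hrn α β hαβ
    rw [ih r hrn α β hαβ, F.π_sum_zeta_mul_twos hr, κ, zagierCoeff_def, hαβ, show r - 1 + 1 = r by omega]
  set R := ∑ j ∈ Finset.range n, κ a b j • (F.J (rho [2 * j + 3]) * F.z (List.replicate (n - 1 - j) 2))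
    with hR
  -- `D_{<2n+1}` kills the difference
  have hD : ∀ r : ℕ, 1 ≤ r → 2 * r + 1 < 2 * n + 1 → F.D r (F.z (tt a b) - R) = 0 := by
    intro r hr hlt
    rw [map_sub, F.lemma_3_5 hr, F.π_ξ hr (by omega) (ihπ r hr (by omega)), hR, map_sum]
    simp_rw [map_smul, F.D_zeta_mul_twos hr]
    rw [Finset.sum_eq_single (r - 1), if_pos (by omega), show a + b + 1 - r = n - 1 - (r - 1) by omega, κ,
      show r - 1 + 1 = r by omega, TensorProduct.smul_tmul', sub_self]
    · intro j _ hj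
      rw [if_neg (by omega), smul_zero]
    · intro h
      exact absurd (Finset.mem_range.2 (by omega)) h
  have hmem : F.z (tt a b) - R ∈ F.Hw (2 * n + 1) := by
    refine Submodule.sub_mem _ ?_ (Submodule.sum_mem _ fun j hj => Submodule.smul_mem _ _ ?_)
    · have := F.z_mem_hoffman (isHoffman_tt a b)
      rwa [weight_tt, show 2 * (a + b) + 3 = 2 * n + 1 by omega] at this
    · have h1 : F.J (rho [2 * j + 3]) ∈ F.Hw (2 * j + 3) := by
        have := F.J_mem (rho [2 * j + 3])
        rwa [length_rho_of_pos (by simp), show weight [2 * j + 3] = 2 * j + 3 by simp [weight]] at this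
      have h2 := F.z_mem_hoffman (isHoffman_replicate_two (n - 1 - j))
      rw [weight_replicate_two] at h2
      have h3 := F.mul_mem h1 h2
      have hj' := Finset.mem_range.1 hj
      rwa [show 2 * j + 3 + 2 * (n - 1 - j) = 2 * n + 1 by omega] at h3
  obtain ⟨c, hc⟩ := F.kernel (2 * n + 1) (by omega) _ hmem hD
  -- the period map and the real theorem
  have e2 : ∀ j, F.per (F.J (rho [2 * j + 3])) = multipleZeta [2 * j + 3] := fun j => by
    simpa using F.per_J [2 * j + 3] (MZV.isAdmissible_singleton_of_two_le (by omega))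
  have e3 : ∀ m, F.per (F.z (List.replicate m 2)) = multipleZeta (List.replicate m 2) := fun m => by
    have := F.per_J (List.replicate m 2) (isHoffman_replicate_two m).isAdmissible
    rwa [List.reverse_replicate] at this
  have hper : F.per (F.z (tt a b) - R) = 0 := by
    have e1 : F.per (F.z (tt a b)) = multipleZeta (List.replicate b 2 ++ 3 :: List.replicate a 2) := by
      have := F.per_J (tt b a) (isHoffman_tt b a).isAdmissible
      rwa [reverse_tt] at this
    have hZ' := hZ n b (by omega)
    rw [show n - 1 - b = a by omega] at hZ'
    rw [map_sub, hR, map_sum, e1, hZ', Finset.mul_sum, ← Finset.sum_sub_distrib]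
    refine Finset.sum_eq_zero fun j _ => ?_
    rw [map_smul, map_mul, e2, e3, κ, Rat.smul_def]
    push_cast
    ring
  rw [hc, map_smul] at hper
  have hz : F.per (F.J (rho [2 * n + 1])) = multipleZeta [2 * n + 1] := by
    simpa using F.per_J [2 * n + 1] (MZV.isAdmissible_singleton_of_two_le (by omega))
  rw [hz, smul_eq_zero] at hper
  rcases hper with h0 | h0
  · rw [h0, zero_smul] at hc
    exact sub_eq_zero.1 hc
  · exact absurd h0 (multipleZeta_pos_of_isAdmissible_holds (MZV.isAdmissible_singleton_of_two_le (by omega))).ne'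

/-- **(3.12) with (4.2)**: `π_{a+b+1}(ζᵐ(2^a 3 2^b)) = c_{2^a32^b} ζ_{2(a+b)+3}`, `c = zagierCoeff a b`.
[cite: Brown2012, (3.12) and Theorem 4.3 (4.2)] -/
theorem π_z_tt (hZ : ∀ n b : ℕ, b < n →
      multipleZeta (List.replicate b 2 ++ 3 :: List.replicate (n - 1 - b) 2) =
        2 * ∑ r ∈ Finset.range n, (-1 : ℝ) ^ (r + 1) *
          ((zagierA (r + 1) (n - 1 - b) - zagierB (r + 1) b : ℚ) : ℝ) *
            (multipleZeta [2 * r + 3] * multipleZeta (List.replicate (n - 1 - r) 2))) (a b : ℕ) :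
    F.π (a + b + 1) (F.z (tt a b)) = zagierCoeff a b • F.ζ (a + b + 1) := by
  rw [F.motivicZagier hZ (a + b + 1) a b rfl, F.π_sum_zeta_mul_twos (by omega), κ, zagierCoeff_def,
    show a + b + 1 - 1 + 1 = a + b + 1 by omega]

/-! ### The `ζ_{2r+1}`-component: `CoactionData` from `FullCoactionData` -/

/-- **The coaction data of `BrownCoactionCalculus` from the full structure**: `f r = (ζ_{2r+1} ↦ 1) ∘ π_r`,
`D r = ((ζ_{2r+1} ↦ 1) ⊗ id) ∘ D_{2r+1}`; the four axioms of `CoactionData` are now THEOREMS: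
(3.4) projected, `f_levelOne` = (3.12)/(4.2) (Theorem 4.3, given the real Zagier theorem),
`f_zetaOne` = Lemma 3.8 projected, `ζᵐ(2^n) ≠ 0` from the period (`ζ(2^n) > 0`).
[cite: Brown2012, Definition 5.7 and Theorem 4.3] -/
noncomputable def toCoactionData (hZ : ∀ n b : ℕ, b < n →
      multipleZeta (List.replicate b 2 ++ 3 :: List.replicate (n - 1 - b) 2) =
        2 * ∑ r ∈ Finset.range n, (-1 : ℝ) ^ (r + 1) *
          ((zagierA (r + 1) (n - 1 - b) - zagierB (r + 1) b : ℚ) : ℝ) *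
            (multipleZeta [2 * r + 3] * multipleZeta (List.replicate (n - 1 - r) 2))) : CoactionData where
  H := F.H
  J := F.J
  f := fun r => (F.dualζ r).comp (F.π r)
  D := fun r => F.Dc r
  coaction := fun r hr v => F.Dc_J r hr v
  f_levelOne := fun a b => by
    rw [LinearMap.comp_apply, ← tt, show F.J (rho (tt a b)) = F.z (tt a b) from rfl, F.π_z_tt hZ,
      map_smul, show F.dualζ (a + b + 1) (F.ζ (a + b + 1)) = 1 from F.dualζ_ζ _ (by omega), smul_eq_mul,
      mul_one]
  f_zetaOne := fun r hr => by
    rw [LinearMap.comp_apply, F.π_zetaOne hr, map_smul, show F.dualζ r (F.ζ r) = 1 from F.dualζ_ζ r hr, smul_eq_mul,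
      mul_one]
  J_rho_replicate_two_ne_zero := fun n h => by
    have h1 := F.per_J (List.replicate n 2) (isHoffman_replicate_two n).isAdmissible
    rw [List.reverse_replicate, h, map_zero] at h1
    exact absurd h1.symm (multipleZeta_pos_of_isAdmissible_holds (isHoffman_replicate_two n).isAdmissible).ne'

/-- … and the motivic coaction data (period map and weight pieces). [cite: Brown2012, §2] -/
noncomputable def toMotivicCoactionData (hZ : ∀ n b : ℕ, b < n →
      multipleZeta (List.replicate b 2 ++ 3 :: List.replicate (n - 1 - b) 2) =
        2 * ∑ r ∈ Finset.range n, (-1 : ℝ) ^ (r + 1) *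
          ((zagierA (r + 1) (n - 1 - b) - zagierB (r + 1) b : ℚ) : ℝ) *
            (multipleZeta [2 * r + 3] * multipleZeta (List.replicate (n - 1 - r) 2))) : MotivicCoactionData where
  toCoactionData := F.toCoactionData hZ
  per := F.per.toLinearMap
  per_J := F.per_J
  V := F.Hw
  J_mem := fun s hs => by
    have := F.z_mem (w := s.reverse) (fun a ha => hs.1 a (List.mem_reverse.1 ha))
    rwa [weight_reverse] at this
  finiteDimensional := F.finiteDimensional
  finrank_le := F.finrank_le

end FullCoactionData

end Brown2012

/-- **The named fact from Brown's full coaction structure and Zagier's real theorem** (Brown 2012,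
Theorem 1.1 ⟹ Conjecture 2, with §§3–7 formal): motivic multiple zeta values with Goncharov's
coaction (3.4), Theorem 3.3 (kernel of `D_{<N}`), Lemma 3.8, the period map and `dim H_N ≤ d_N`,
together with Zagier's evaluation of `ζ(2^a32^b)` (Theorem 4.1), imply `hoffmanSpan_eq_mzvSpace`.
[cite: Brown2012, Theorem 1.1] -/
theorem hoffmanSpan_eq_mzvSpace_of_fullCoactionData (F : Brown2012.FullCoactionData)
    (hZ : ∀ n b : ℕ, b < n →
      multipleZeta (List.replicate b 2 ++ 3 :: List.replicate (n - 1 - b) 2) =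
        2 * ∑ r ∈ Finset.range n, (-1 : ℝ) ^ (r + 1) *
          ((Brown2012.zagierA (r + 1) (n - 1 - b) - Brown2012.zagierB (r + 1) b : ℚ) : ℝ) *
            (multipleZeta [2 * r + 3] * multipleZeta (List.replicate (n - 1 - r) 2))) :
    hoffmanSpan_eq_mzvSpace :=
  hoffmanSpan_eq_mzvSpace_of_motivicCoactionData (F.toMotivicCoactionData hZ)

namespace Brown2012

open MZV

/-! ### The coalgebra `𝒰` side: `∂_{2r+1}`, Lemma 2.7, and Theorem 3.3 from `H ↪ 𝒰` -/

/-- The weight-`N` basis of `𝒰 = ℚ⟨f₃,f₅,…⟩ ⊗ ℚ[f₂]` ((2.21)): Brown's monomials `f₂^m f_{b₁}⋯f_{b_r}`,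
indexed by `(m, [b₁,…,b_r])` with the `bᵢ` odd `> 1` and `2m + ∑ bᵢ = N` (the index set of
`card_brownMonomial_eq_zagierDim`, Lemma 2.5). [cite: Brown2012, (2.21) and Lemma 2.5] -/
def uBasis (N : ℕ) : Set (ℕ × List ℕ) := {p | (∀ b ∈ p.2, Odd b ∧ 1 < b) ∧ 2 * p.1 + p.2.sum = N}

/-- `𝒰` as finitely supported functions on all pairs `(m, w)`; its weight-`N` piece `𝒰_N` is the
subspace supported on the weight-`N` monomials. [cite: Brown2012, (2.21)] -/
def uWeight (N : ℕ) : Submodule ℚ (ℕ × List ℕ →₀ ℚ) := Finsupp.supported ℚ ℚ (uBasis N)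

/-- Prefixing the word by the letter `f_{2r+1}`. [folklore] -/
theorem consLetter_injective (r : ℕ) :
    Function.Injective fun p : ℕ × List ℕ => (p.1, (2 * r + 1) :: p.2) := by
  rintro ⟨m, w⟩ ⟨m', w'⟩ h
  simp only [Prod.mk.injEq, List.cons.injEq, true_and] at h
  exact Prod.ext h.1 h.2

/-- **`∂_{2r+1} = (f^∨_{2r+1} ⊗ id) ∘ D_{2r+1}` on `𝒰`**: it removes the initial letter `f_{2r+1}` of
a monomial (deconcatenation coproduct (2.20), and `f^∨_{2r+1}` = coefficient of the one-letter word
`f_{2r+1}`, killing all longer words) — proof of Lemma 2.7: "`(f^∨_{2r+1} ⊗ id) ∘ D_{2r+1} ξ = v_r`".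
[cite: Brown2012, (2.20), (2.25) and proof of Lemma 2.7] -/
noncomputable def dU (r : ℕ) : (ℕ × List ℕ →₀ ℚ) →ₗ[ℚ] (ℕ × List ℕ →₀ ℚ) :=
  Finsupp.lcomapDomain (fun p : ℕ × List ℕ => (p.1, (2 * r + 1) :: p.2)) (consLetter_injective r)

/-- `(∂_{2r+1} x)(m, w) = x(m, f_{2r+1} w)`. [folklore] -/
@[simp] theorem dU_apply (r : ℕ) (x : ℕ × List ℕ →₀ ℚ) (p : ℕ × List ℕ) :
    dU r x p = x (p.1, (2 * r + 1) :: p.2) := rfl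

/-- `f_N ∈ 𝒰_N`: the letter `f_N` for `N` odd, `f₂^{N/2}` (`∝ f_N`, Definition 2.6) for `N` even.
[cite: Brown2012, Definition 2.6] -/
noncomputable def fU (N : ℕ) : ℕ × List ℕ →₀ ℚ :=
  if Odd N then Finsupp.single (0, [N]) 1 else Finsupp.single (N / 2, []) 1

/-- **Brown 2012, Lemma 2.7** (`(ker D_{<N}) ∩ 𝒰_N = ℚ f_N`, through the `f^∨_{2r+1}`-components):
if `ξ ∈ 𝒰_N` (`N ≥ 2`) is killed by all `∂_{2r+1}`, `3 ≤ 2r+1 < N`, then `ξ ∈ ℚ f_N` ("if `ξ` is in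
the kernel of `D_{<N}` then it is of the form `ξ = c f_N`"). [cite: Brown2012, Lemma 2.7] -/
theorem lemma_2_7 {N : ℕ} {x : ℕ × List ℕ →₀ ℚ} (hx : x ∈ uWeight N)
    (hD : ∀ r : ℕ, 1 ≤ r → 2 * r + 1 < N → dU r x = 0) : ∃ c : ℚ, x = c • fU N := by
  classical
  set idx : ℕ × List ℕ := if Odd N then (0, [N]) else (N / 2, []) with hidx
  have hsupp : ∀ p ∈ x.support, p = idx := by
    intro p hp
    have hv := hx hp
    simp only [uBasis, Set.mem_setOf_eq] at hv
    obtain ⟨hodd, hwt⟩ := hv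
    obtain ⟨m, w⟩ := p
    rcases w with _ | ⟨b, w⟩
    · simp only [List.sum_nil, add_zero] at hwt
      have he : ¬ Odd N := by rw [Nat.not_odd_iff_even]; exact ⟨m, by omega⟩
      rw [hidx, if_neg he]
      simp only [Prod.mk.injEq, and_true]
      omega
    · obtain ⟨hb, hb1⟩ := hodd b (by simp)
      obtain ⟨r, rfl⟩ := hb
      simp only [List.sum_cons] at hwt
      by_cases hlt : 2 * r + 1 < N
      · exfalso
        have h0 := hD r (by omega) hlt
        have : x (m, (2 * r + 1) :: w) = 0 := by
          have := DFunLike.congr_fun h0 (m, w)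
          simpa using this
        exact (Finsupp.mem_support_iff.1 hp) this
      · have hw : w = [] := by
          rcases w with _ | ⟨b', w'⟩
          · rfl
          · have := (hodd b' (by simp)).2
            simp only [List.sum_cons] at hwt
            omega
        subst hw
        simp only [List.sum_nil, add_zero] at hwt
        have hN' : N = 2 * r + 1 := by omega
        have ho : Odd N := ⟨r, hN'⟩
        rw [hidx, if_pos ho]
        simp only [Prod.mk.injEq, List.cons.injEq, and_true]
        omega
  refine ⟨x idx, ?_⟩
  have hx' : x = Finsupp.single idx (x idx) :=
    (Finsupp.support_subset_singleton.1 fun p hp => Finset.mem_singleton.2 (hsupp p hp))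
  have hfU : fU N = Finsupp.single idx 1 := by
    rw [fU, hidx]
    split_ifs <;> rfl
  rw [hfU, Finsupp.smul_single, smul_eq_mul, mul_one]
  exact hx'

/-- `𝒰_N` is finite-dimensional, of dimension `d_N` (Lemma 2.5). [cite: Brown2012, Lemma 2.5] -/
theorem finrank_uWeight (N : ℕ) :
    FiniteDimensional ℚ (uWeight N) ∧ Module.finrank ℚ (uWeight N) = zagierDim N := by
  haveI : Finite (uBasis N) := finite_brownMonomial N
  letI : Fintype (uBasis N) := Fintype.ofFinite _
  let e : uWeight N ≃ₗ[ℚ] (uBasis N → ℚ) :=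
    (Finsupp.supportedEquivFinsupp (uBasis N)).trans (Finsupp.linearEquivFunOnFinite ℚ ℚ (uBasis N))
  refine ⟨LinearEquiv.finiteDimensional e.symm, ?_⟩
  rw [LinearEquiv.finrank_eq e, Module.finrank_fintype_fun_eq_card, ← Nat.card_eq_fintype_card]
  exact card_brownMonomial_eq_zagierDim N



/-- **Brown's motivic structure with `H ⊆ H^{MT⁺} ≅ 𝒰`** ((2.15), (2.22), (3.6)): the pre-coaction
data together with a `ℚ`-linear map `φ : H → 𝒰` — the comodule embedding followed by the
non-canonical isomorphism `φ` of (2.22), normalized by (3.6) — which respects the weight, is injective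
on each `H_N` ((2.15) is injective), intertwines the `ζ_{2r+1}`-components of `D_{2r+1}` with
`∂_{2r+1}` on `𝒰` (`φ` is a morphism of comodules; Lemma 2.7's `(f^∨_{2r+1} ⊗ id) ∘ D_{2r+1}`), and
sends `ζᵐ(N)` to a non-zero multiple of `f_N` ((3.6), Definition 2.6: `f_{2n} = b_n f₂ⁿ`). From this,
Theorem 3.3 and `dim H_N ≤ d_N` are THEOREMS (`toFullCoactionData`).
[cite: Brown2012, (2.15), (2.22), (3.6), Theorem 3.3] -/
structure UCoactionData extends PreCoactionData where
  /-- `φ : H ⊆ H^{MT⁺} ≅ 𝒰` ((2.15), (2.22)). -/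
  φ : H →ₗ[ℚ] (ℕ × List ℕ →₀ ℚ)
  /-- `φ` respects the weight grading. -/
  φ_mem : ∀ (N : ℕ) (x : H), x ∈ Hw N → φ x ∈ uWeight N
  /-- (2.15) is injective. -/
  φ_inj : ∀ N : ℕ, Set.InjOn φ (Hw N)
  /-- `φ` intertwines `((ζ_{2r+1} ↦ 1) ⊗ id) ∘ D_{2r+1}` with `∂_{2r+1}` (comodule morphism). -/
  φ_D : ∀ r : ℕ, 1 ≤ r → ∀ x : H, φ (toPreCoactionData.Dc r x) = dU r (φ x)
  /-- (3.6) & Definition 2.6: `φ(ζᵐ(N)) = f_N` (`N` odd), `= b_{N/2} f₂^{N/2}` (`N` even), `b ≠ 0`. -/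
  φ_zeta : ∀ N : ℕ, 2 ≤ N → ∃ c : ℚ, c ≠ 0 ∧ φ (J (rho [N])) = c • fU N

namespace UCoactionData

variable (G : UCoactionData)

/-- **Brown 2012, Theorem 3.3, from Lemma 2.7 via `φ`**: `ker D_{<N} ∩ H_N ⊆ ℚ ζᵐ(N)`.
[cite: Brown2012, Theorem 3.3] -/
theorem kernel (N : ℕ) (hN : 2 ≤ N) (ξ : G.H) (hξ : ξ ∈ G.Hw N)
    (hD : ∀ r : ℕ, 1 ≤ r → 2 * r + 1 < N → G.D r ξ = 0) : ∃ c : ℚ, ξ = c • G.J (rho [N]) := by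
  have hDc : ∀ r : ℕ, 1 ≤ r → 2 * r + 1 < N → dU r (G.φ ξ) = 0 := by
    intro r hr hlt
    rw [← G.φ_D r hr ξ, PreCoactionData.Dc, LinearMap.comp_apply, LinearMap.comp_apply, hD r hr hlt,
      map_zero, map_zero, map_zero]
  obtain ⟨c', hc'⟩ := lemma_2_7 (G.φ_mem N ξ hξ) hDc
  obtain ⟨c, hc0, hc⟩ := G.φ_zeta N hN
  have hzmem : G.J (rho [N]) ∈ G.Hw N := by
    have := G.J_mem (rho [N])
    rwa [length_rho_of_pos (by simp; omega), show weight [N] = N by simp [weight]] at this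
  refine ⟨c' / c, G.φ_inj N hξ (Submodule.smul_mem _ _ hzmem) ?_⟩
  rw [map_smul, hc, hc', smul_smul, div_mul_cancel₀ _ hc0]

/-- `H_N` is finite-dimensional with `dim H_N ≤ d_N`, by the injection into `𝒰_N` (Lemma 2.5).
[cite: Brown2012, (2.15) and (2.23)] -/
theorem finrank_le (N : ℕ) :
    FiniteDimensional ℚ (G.Hw N) ∧ Module.finrank ℚ (G.Hw N) ≤ zagierDim N := by
  obtain ⟨hfd, hrk⟩ := finrank_uWeight N
  haveI := hfd
  let ψ : G.Hw N →ₗ[ℚ] uWeight N := (G.φ.domRestrict (G.Hw N)).codRestrict (uWeight N)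
    (fun x => G.φ_mem N x.1 x.2)
  have hψ : Function.Injective ψ := by
    intro x y h
    apply Subtype.ext
    apply G.φ_inj N x.2 y.2
    have := congrArg Subtype.val h
    simpa [ψ] using this
  haveI : FiniteDimensional ℚ (G.Hw N) := Module.Finite.of_injective ψ hψ
  exact ⟨inferInstance, by rw [← hrk]; exact LinearMap.finrank_le_finrank_of_injective hψ⟩

/-- **The full structure from `H ↪ 𝒰`**: Theorem 3.3 and the dimension bound are now derived.
[cite: Brown2012, Theorem 3.3 and (2.23)] -/
noncomputable def toFullCoactionData : FullCoactionData where
  toPreCoactionData := G.toPreCoactionData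
  kernel := G.kernel
  finiteDimensional := fun N => (G.finrank_le N).1
  finrank_le := fun N => (G.finrank_le N).2

end UCoactionData

end Brown2012

/-- **The named fact from Brown's structure `(H, Iᵐ, D, per, H ↪ 𝒰)` and Zagier's real theorem**
(Brown 2012, Theorem 1.1 ⟹ Conjecture 2, with Lemma 2.7, Theorem 3.3 and §§3–7 formal).
[cite: Brown2012, Theorem 1.1] -/
theorem hoffmanSpan_eq_mzvSpace_of_uCoactionData (G : Brown2012.UCoactionData)
    (hZ : ∀ n b : ℕ, b < n →
      multipleZeta (List.replicate b 2 ++ 3 :: List.replicate (n - 1 - b) 2) =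
        2 * ∑ r ∈ Finset.range n, (-1 : ℝ) ^ (r + 1) *
          ((Brown2012.zagierA (r + 1) (n - 1 - b) - Brown2012.zagierB (r + 1) b : ℚ) : ℝ) *
            (multipleZeta [2 * r + 3] * multipleZeta (List.replicate (n - 1 - r) 2))) :
    hoffmanSpan_eq_mzvSpace :=
  hoffmanSpan_eq_mzvSpace_of_fullCoactionData G.toFullCoactionData hZ


end Literature.NumberTheory.Transcendental
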